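import Summits.AtomisticToContinuum.HydrodynamicLimit.Theses.OneFlightGossipEngine
import Literature.MathematicalPhysics.KineticTheory.HardSphereEulerProofs
import Literature.Barriers.AtomisticToContinuum.HighMomentumCutoffNarrow

/-!
# `EnergyCurrentTails` (stmt-AtomisticToContinuum-9235), negative knowledge 1/2: the cubic tail functional has no exponential moment under any local Gibbs law

Load-bearing / strengthening analysis of the crux
`OneFlightGossipEngine.EnergyCurrentTails` (shared verbatim by WarmColdDichotomy,
BallwiseInvariantReferences, AnosovDiceHopf, TwoClocks, JaynesSqueeze, PesinPricing, ExpTailStaging)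
by the standing disprover (`Cruxes/EnergyCurrentTails/Disproof.lean`,
refuter-cdisprove-stmt-AtomisticToContinuum-9235-0).

The crux asks for UNIFORM INTEGRABILITY of the empirical cubic tail
`(N+1)⁻¹ ∑ᵢ 𝟙{M < |vᵢ(s)|} |vᵢ(s)|³` under the evolved local Gibbs law.  This file records, in the
crux's exact currency, why the statement cannot be upgraded to (or proved through) the
exponential-moment / window-large-deviation currency of the route's other cruxes
(`KineticCurrentsWindowLD`, `CollisionalWindowLD`, the entropy inequality of `EngineDock`):

* `lintegral_exp_tail3_gaussMeasure_eq_top`: for every drift `u`, temperature `θ > 0`, `β > 0` and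
  cut-off `M`, `∫ exp(β 𝟙{M<|w|}|w|³) N(u, θ I₃)(dw) = ∞` (drifted form of conjunct (2) of the
  catalogued barrier `HighMomentumCutoffBarrierNarrow`, which is the case `u = 0`);
* `lintegral_exp_sum_tail3_localGibbsMeasure_eq_top`: for EVERY local Gibbs law with continuous
  profiles `a₀ > 0`, `θ₀ > 0`, `u₀`, every `σ ≤ 1/2`, every `N`, `β > 0`, `M`:
  `E_{λ_N} exp(β ∑ᵢ 𝟙{M<|vᵢ|}|vᵢ|³) = ∞` already at time `0` (disintegration
  `lintegral_localGibbsMeasure` + the one-body divergence on sphere `0`);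
* `energyCurrentTailsExpMoment_false`: hence the natural strengthening `EnergyCurrentTailsExpMoment`
  ("for some `β > 0` the exponential moment of `β ∑ᵢ tailᵢ` is `≤ exp(ε(N+1))` eventually") is FALSE.

MESSAGE: any consumer must take EnergyCurrentTails as uniform integrability (polynomial / Chebyshev
currency); it can never sit inside a `Λ_τ(β)`.  The crux itself is NOT refuted (see the Disproof
workfile: true at global equilibrium by invariance, open off equilibrium).
-/

noncomputable section

open MeasureTheory Filter Set Topology
open scoped ENNReal

namespace Summit.AtomisticToContinuum.HydrodynamicLimit.Theorems

namespace EnergyCurrentTailsNegative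

open Literature.MathematicalPhysics.KineticTheory Literature.Analysis.FluidPDE

/-! ### The crux functional -/

/-- One-particle cubic tail `𝟙{M < |v|} |v|³` (the crux's summand). -/
def tail3 (M : ℝ) (v : V3) : ℝ := Set.indicator {v : V3 | M < ‖v‖} (fun v => ‖v‖ ^ 3) v

/-- One-particle quadratic (kinetic-energy) tail `𝟙{M < |v|} |v|²`. -/
def tail2 (M : ℝ) (v : V3) : ℝ := Set.indicator {v : V3 | M < ‖v‖} (fun v => ‖v‖ ^ 2) v

/-- The crux's empirical cubic tail `(N+1)⁻¹ ∑ᵢ 𝟙{M < |vᵢ|} |vᵢ|³`. -/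
def cubicTail (N : ℕ) (M : ℝ) (z : Config (N + 1) (Fin 3) T3) : ℝ :=
  ((N : ℝ) + 1)⁻¹ * ∑ i : Fin (N + 1), tail3 M (z i).2

/-- The empirical quadratic tail `(N+1)⁻¹ ∑ᵢ 𝟙{M < |vᵢ|} |vᵢ|²`. -/
def quadTail (N : ℕ) (M : ℝ) (z : Config (N + 1) (Fin 3) T3) : ℝ :=
  ((N : ℝ) + 1)⁻¹ * ∑ i : Fin (N + 1), tail2 M (z i).2

/-- `cubicTail` is literally the crux's integrand. -/
theorem cubicTail_eq (N : ℕ) (M : ℝ) (z : Config (N + 1) (Fin 3) T3) :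
    cubicTail N M z = ((N : ℝ) + 1)⁻¹ *
      ∑ i : Fin (N + 1), Set.indicator {v : V3 | M < ‖v‖} (fun v => ‖v‖ ^ 3) (z i).2 := rfl

/-- The cubic tail is nonnegative. -/
theorem tail3_nonneg (M : ℝ) (v : V3) : 0 ≤ tail3 M v :=
  Set.indicator_nonneg (fun w _ => by positivity) v

/-- The quadratic tail is nonnegative. -/
theorem tail2_nonneg (M : ℝ) (v : V3) : 0 ≤ tail2 M v :=
  Set.indicator_nonneg (fun w _ => by positivity) v

/-- Above the cut-off the cubic tail is `|v|³`. -/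
theorem tail3_of_lt {M : ℝ} {v : V3} (h : M < ‖v‖) : tail3 M v = ‖v‖ ^ 3 :=
  Set.indicator_of_mem (show v ∈ {v : V3 | M < ‖v‖} from h) _

/-- Below the cut-off the cubic tail vanishes. -/
theorem tail3_of_le {M : ℝ} {v : V3} (h : ‖v‖ ≤ M) : tail3 M v = 0 :=
  Set.indicator_of_notMem (show v ∉ {v : V3 | M < ‖v‖} from fun h' => (not_lt.2 h) h') _

/-- The quadratic tail is at most `|v|²`. -/
theorem tail2_le (M : ℝ) (v : V3) : tail2 M v ≤ ‖v‖ ^ 2 :=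
  Set.indicator_le_self' (fun _ _ => by positivity) v

/-- The cubic tail of the zero velocity vanishes (nonnegative cut-off). -/
theorem tail3_zero (M : ℝ) (hM : 0 ≤ M) : tail3 M (0 : V3) = 0 :=
  tail3_of_le (by simpa using hM)

/-- The quadratic tail of the zero velocity vanishes (nonnegative cut-off). -/
theorem tail2_zero (M : ℝ) (hM : 0 ≤ M) : tail2 M (0 : V3) = 0 := by
  unfold tail2
  exact Set.indicator_of_notMem (by simpa using hM) _

/-- The empirical cubic tail is nonnegative. -/
theorem cubicTail_nonneg (N : ℕ) (M : ℝ) (z : Config (N + 1) (Fin 3) T3) : 0 ≤ cubicTail N M z :=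
  mul_nonneg (by positivity) (Finset.sum_nonneg fun i _ => tail3_nonneg M _)

/-- The empirical quadratic tail is nonnegative. -/
theorem quadTail_nonneg (N : ℕ) (M : ℝ) (z : Config (N + 1) (Fin 3) T3) : 0 ≤ quadTail N M z :=
  mul_nonneg (by positivity) (Finset.sum_nonneg fun i _ => tail2_nonneg M _)

/-- The cubic tail is measurable. -/
theorem measurable_tail3 (M : ℝ) : Measurable (tail3 M) := by
  unfold tail3
  exact (measurable_norm.pow_const 3).indicator (measurableSet_lt measurable_const measurable_norm)

/-- The empirical cubic tail is measurable. -/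
theorem measurable_cubicTail (N : ℕ) (M : ℝ) : Measurable (cubicTail N M) := by
  unfold cubicTail
  refine Measurable.const_mul (Finset.measurable_sum _ fun i _ => ?_) _
  exact (measurable_tail3 M).comp (measurable_snd.comp (measurable_pi_apply i))

/-! ### One body: no exponential cubic moment under a Maxwellian -/

/-- One-body shadow (re-export of the catalogued barrier conjunct): the cubic observable has NO
finite exponential moment under any Maxwellian. -/
theorem not_exists_expCubicMoment_maxwellian :
    ¬ ∃ θ : ℝ, 0 < θ ∧ ∃ lam : ℝ, 0 < lam ∧
      ∫⁻ v : V3, ENNReal.ofReal (Real.exp (lam * ‖v‖ ^ 3 - ‖v‖ ^ 2 / (2 * θ))) < ∞ := by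
  rintro ⟨θ, hθ, lam, hlam, h⟩
  rw [Literature.Barriers.AtomisticToContinuum.lintegral_exp_cubic_eq_top hθ hlam] at h
  exact lt_irrefl _ h


/-! ### The `N`-body form at `t = 0`: under EVERY local Gibbs law the crux functional has no
exponential moment (so it cannot enter the window-LD / Varadhan currency of the route's other
cruxes, and the entropy inequality cannot truncate it — the catalogued barrier in the exact
currency of stmt-9235) -/

section GibbsExpMoment

variable {a₀ θ₀ : T3 → ℝ} {u₀ : T3 → V3}

/-- The exponential cubic tail weight is measurable. -/
theorem measurable_exp_tail3 (β M : ℝ) :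
    Measurable fun w : V3 => ENNReal.ofReal (Real.exp (β * tail3 M w)) :=
  (Real.measurable_exp.comp ((measurable_tail3 M).const_mul β)).ennreal_ofReal

/-- One body: `∫ exp(β 𝟙{M<|w|}|w|³) N(u, θ)(dw) = ∞` for every drift `u`, temperature `θ > 0`,
`β > 0` and cut-off `M` (drifted version of the barrier conjunct
`Literature.Barriers.AtomisticToContinuum.setLIntegral_exp_cubic_eq_top`). -/
theorem lintegral_exp_tail3_gaussMeasure_eq_top {θ : ℝ} (hθ : 0 < θ) (u : V3) {β : ℝ}
    (hβ : 0 < β) (M : ℝ) :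
    ∫⁻ w, ENNReal.ofReal (Real.exp (β * tail3 M w)) ∂(gaussMeasure u θ) = ∞ := by
  rw [← withDensity_localMaxwellian_eq_gaussMeasure hθ u,
    lintegral_withDensity_eq_lintegral_mul _
      (continuous_localMaxwellian 1 θ u).measurable.ennreal_ofReal (measurable_exp_tail3 β M)]
  -- constants
  set K : ℝ := (2 * Real.pi * θ) ^ (-(Module.finrank ℝ V3 : ℝ) / 2) with hK
  have hK0 : 0 < K := Real.rpow_pos_of_pos (by positivity) _
  set C : ℝ := K * Real.exp (-‖u‖ ^ 2 / θ) with hC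
  have hC0 : 0 < C := mul_pos hK0 (Real.exp_pos _)
  have hMx : ∀ w : V3, localMaxwellian 1 θ u w = K * Real.exp (-‖w - u‖ ^ 2 / (2 * θ)) := by
    intro w
    simp [localMaxwellian, hK]
  -- pointwise lower bound on the tail region
  have hpt : ∀ w ∈ {w : V3 | M < ‖w‖},
      ENNReal.ofReal C * ENNReal.ofReal (Real.exp (β * ‖w‖ ^ 3 - ‖w‖ ^ 2 / (2 * (θ / 2)))) ≤
        (fun v => ENNReal.ofReal (localMaxwellian 1 θ u v)) w *
          ENNReal.ofReal (Real.exp (β * tail3 M w)) := by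
    intro w hw
    have hw' : M < ‖w‖ := hw
    simp only
    rw [← ENNReal.ofReal_mul hC0.le,
      ← ENNReal.ofReal_mul (localMaxwellian_nonneg zero_le_one hθ.le u w), hMx w, tail3_of_lt hw',
      hC, mul_assoc, mul_assoc, ← Real.exp_add, ← Real.exp_add]
    refine ENNReal.ofReal_le_ofReal (mul_le_mul_of_nonneg_left (Real.exp_le_exp.2 ?_) hK0.le)
    have h2 : ‖w - u‖ ^ 2 ≤ 2 * ‖w‖ ^ 2 + 2 * ‖u‖ ^ 2 := by
      have h := norm_sub_le w u
      nlinarith [norm_nonneg (w - u), norm_nonneg w, norm_nonneg u, sq_nonneg (‖w‖ - ‖u‖)]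
    have key : ‖w - u‖ ^ 2 / (2 * θ) ≤ ‖u‖ ^ 2 / θ + ‖w‖ ^ 2 / θ := by
      rw [← add_div, div_le_div_iff₀ (by positivity) hθ]
      nlinarith
    have hθ2 : (2 * (θ / 2)) = θ := by ring
    rw [hθ2]
    have : -‖u‖ ^ 2 / θ + (β * ‖w‖ ^ 3 - ‖w‖ ^ 2 / θ) =
        β * ‖w‖ ^ 3 - (‖u‖ ^ 2 / θ + ‖w‖ ^ 2 / θ) := by ring
    rw [this, neg_div]
    linarith
  have hmeasI : Measurable fun w : V3 =>
      ENNReal.ofReal (Real.exp (β * ‖w‖ ^ 3 - ‖w‖ ^ 2 / (2 * (θ / 2)))) :=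
    (Real.measurable_exp.comp (((measurable_norm.pow_const 3).const_mul β).sub
      ((measurable_norm.pow_const 2).div_const _))).ennreal_ofReal
  refine top_le_iff.1 ?_
  calc (⊤ : ℝ≥0∞)
      = ENNReal.ofReal C * ∫⁻ w in {w : V3 | M < ‖w‖},
          ENNReal.ofReal (Real.exp (β * ‖w‖ ^ 3 - ‖w‖ ^ 2 / (2 * (θ / 2)))) := by
        rw [Literature.Barriers.AtomisticToContinuum.setLIntegral_exp_cubic_eq_top (half_pos hθ) hβ M,
          ENNReal.mul_top (by simpa using hC0)]
    _ = ∫⁻ w in {w : V3 | M < ‖w‖}, ENNReal.ofReal C *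
          ENNReal.ofReal (Real.exp (β * ‖w‖ ^ 3 - ‖w‖ ^ 2 / (2 * (θ / 2)))) :=
        (lintegral_const_mul _ hmeasI).symm
    _ ≤ ∫⁻ w in {w : V3 | M < ‖w‖}, (fun v => ENNReal.ofReal (localMaxwellian 1 θ u v)) w *
          ENNReal.ofReal (Real.exp (β * tail3 M w)) :=
        setLIntegral_mono' (measurableSet_lt measurable_const measurable_norm) hpt
    _ ≤ ∫⁻ w, (fun v => ENNReal.ofReal (localMaxwellian 1 θ u v)) w *
          ENNReal.ofReal (Real.exp (β * tail3 M w)) := setLIntegral_le_lintegral _ _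
    _ = _ := rfl

/-- **`N` bodies, time `0`: `E_{λ_N} exp(β ∑ᵢ 𝟙{M<|vᵢ|}|vᵢ|³) = ∞`** for every local Gibbs law
with continuous profiles (`a₀ > 0`, `θ₀ > 0`), every `σ ≤ 1/2`, every `N`, every `β > 0` and every
cut-off `M` (disintegration `lintegral_localGibbsMeasure` + the one-body divergence on sphere
`0`). -/
theorem lintegral_exp_sum_tail3_localGibbsMeasure_eq_top (ha : Continuous a₀) (hθ : Continuous θ₀)
    (hu : Continuous u₀) (ha0 : ∀ x, 0 < a₀ x) (hθ0 : ∀ x, 0 < θ₀ x) {σ : ℝ} (hσ2 : σ ≤ 1 / 2)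
    (N : ℕ) {β : ℝ} (hβ : 0 < β) (M : ℝ) :
    ∫⁻ z, ENNReal.ofReal (Real.exp (β * ∑ i : Fin (N + 1), tail3 M (z i).2))
      ∂(localGibbsMeasure σ a₀ u₀ θ₀ N) = ∞ := by
  haveI := isProbabilityMeasure_localGibbsMeasure ha hθ hu ha0 hθ0 hσ2 N
  set G : Config (N + 1) (Fin 3) T3 → ℝ≥0∞ :=
    fun z => ENNReal.ofReal (Real.exp (β * ∑ i : Fin (N + 1), tail3 M (z i).2)) with hG
  have hGm : Measurable G := by
    refine (Real.measurable_exp.comp (Measurable.const_mul ?_ β)).ennreal_ofReal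
    exact Finset.measurable_sum _ fun i _ =>
      (measurable_tail3 M).comp (measurable_snd.comp (measurable_pi_apply i))
  have hmeas1 : Measurable fun w : V3 => ENNReal.ofReal (Real.exp (β * tail3 M w)) :=
    measurable_exp_tail3 β M
  rw [lintegral_localGibbsMeasure ha hθ hu (fun x => (ha0 x).le) hθ0 σ N hGm]
  have hinner : ∀ x : Fin (N + 1) → T3, ∫⁻ v, G (zipConfig (x, v)) ∂velMeasure u₀ θ₀ x = ⊤ := by
    intro x
    refine top_le_iff.1 ?_
    have hle : ∀ v : Fin (N + 1) → V3,
        ENNReal.ofReal (Real.exp (β * tail3 M (v 0))) ≤ G (zipConfig (x, v)) := by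
      intro v
      refine ENNReal.ofReal_le_ofReal (Real.exp_le_exp.2 (mul_le_mul_of_nonneg_left ?_ hβ.le))
      simp only [zipConfig_apply]
      exact Finset.single_le_sum (fun i _ => tail3_nonneg M (v i)) (Finset.mem_univ 0)
    calc (⊤ : ℝ≥0∞)
        = ∫⁻ w, ENNReal.ofReal (Real.exp (β * tail3 M w)) ∂(gaussMeasure (u₀ (x 0)) (θ₀ (x 0))) :=
          (lintegral_exp_tail3_gaussMeasure_eq_top (hθ0 _) _ hβ M).symm
      _ = ∫⁻ v, ENNReal.ofReal (Real.exp (β * tail3 M (v 0))) ∂velMeasure u₀ θ₀ x := by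
          unfold velMeasure
          exact ((measurePreserving_eval (fun i => gaussMeasure (u₀ (x i)) (θ₀ (x i))) 0).lintegral_comp
            hmeas1).symm
      _ ≤ ∫⁻ v, G (zipConfig (x, v)) ∂velMeasure u₀ θ₀ x := lintegral_mono hle
  simp_rw [hinner]
  have hfm : Measurable fun x : Fin (N + 1) → T3 => ENNReal.ofReal
      ((canonicalPartition (Torus.geometry (Fin 3)) (hsDiameter σ N) (N + 1)
        (localGibbsProfile a₀ u₀ θ₀))⁻¹ * posWeight a₀ (hsDiameter σ N) (N + 1) x) :=
    ((measurable_posWeight ha _ _).const_mul _).ennreal_ofReal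
  rw [lintegral_mul_const _ hfm, lintegral_posWeight_eq_one ha hθ hu (fun x => (ha0 x).le) hθ0 σ N,
    one_mul]

/-- The exponential-moment strengthening of the crux at time `0` (the currency a window-LD /
entropy-inequality proof would need): for some `β > 0` the exponential moment of `β ∑ᵢ tailᵢ`
grows at most like `exp(ε(N+1))`. -/
def EnergyCurrentTailsExpMoment : Prop :=
  ∀ (a₀ θ₀ : T3 → ℝ) (u₀ : T3 → V3), Continuous a₀ → Continuous θ₀ → Continuous u₀ →
    (∀ x, 0 < a₀ x) → (∀ x, 0 < θ₀ x) →
    ∃ σ₀ : ℝ, 0 < σ₀ ∧ ∀ σ : ℝ, 0 < σ → σ < σ₀ → ∃ β : ℝ, 0 < β ∧ ∀ ε : ℝ, 0 < ε →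
      ∃ M : ℝ, ∃ N₀ : ℕ, ∀ N : ℕ, N₀ ≤ N →
        ∫⁻ z, ENNReal.ofReal (Real.exp (β * ∑ i : Fin (N + 1),
            Set.indicator {v : V3 | M < ‖v‖} (fun v => ‖v‖ ^ 3) (z i).2))
          ∂(localGibbsMeasure σ a₀ u₀ θ₀ N) ≤ ENNReal.ofReal (Real.exp (ε * ((N : ℝ) + 1)))

/-- **The exponential-moment (LD-currency) strengthening is false at `t = 0`** (homogeneous
profile `a₀ = 1`, `u₀ = 0`, `θ₀ = 1`; any `σ ≤ 1/2` in the alleged range). -/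
theorem energyCurrentTailsExpMoment_false : ¬ EnergyCurrentTailsExpMoment := by
  intro h
  obtain ⟨σ₀, hσ₀, hσ⟩ := h (fun _ => 1) (fun _ => 1) (fun _ => 0) continuous_const continuous_const
    continuous_const (fun _ => one_pos) (fun _ => one_pos)
  set σ : ℝ := min (σ₀ / 2) (1 / 2) with hσdef
  have hσpos : 0 < σ := lt_min (half_pos hσ₀) (by norm_num)
  have hσlt : σ < σ₀ := (min_le_left _ _).trans_lt (half_lt_self hσ₀)
  have hσ2 : σ ≤ 1 / 2 := min_le_right _ _
  obtain ⟨β, hβ, hε⟩ := hσ σ hσpos hσlt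
  obtain ⟨M, N₀, hN⟩ := hε 1 one_pos
  have key := hN N₀ le_rfl
  have htop := lintegral_exp_sum_tail3_localGibbsMeasure_eq_top (a₀ := fun _ => 1) (θ₀ := fun _ => 1)
    (u₀ := fun _ => 0) continuous_const continuous_const continuous_const (fun _ => one_pos)
    (fun _ => one_pos) hσ2 N₀ hβ M
  unfold tail3 at htop
  rw [htop] at key
  exact ENNReal.ofReal_ne_top (top_le_iff.1 key)

end GibbsExpMoment



end EnergyCurrentTailsNegative

end Summit.AtomisticToContinuum.HydrodynamicLimit.Theorems

end
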